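import Summits.ResolutionOfSingularities.ResolutionOfSingularities.Theorems.EquisingularLiftEquisingularLiftNatTowerVertex
import Summits.ResolutionOfSingularities.ResolutionOfSingularities.Theorems.EquisingularLiftEquisingularLiftNatA5LevelTwo
import Summits.ResolutionOfSingularities.ResolutionOfSingularities.Theorems.EquisingularLiftEquisingularLiftNatVertexNotRegular
import Summits.ResolutionOfSingularities.ResolutionOfSingularities.Theorems.EquisingularLiftEquisingularLiftNatDepthTowerExists
import HarnessLib

/-!
# [OURS] SEVERAL VERTICES OF FINITE BLOW-UP DEPTH ⟹ `IsoHypPoint`, and the `A₅` VERTEX `y₀y₁ + y₂⁶` (depth `2`) — the first depth-2 class of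
# hypersurfaces certified in the route's currency (cruxes `Theses.EquisingularLift.EquisingularLiftNat` / `…NatThree` / `EquisingularLift`,
# stmt-ResolutionOfSingularities-20038 / -20148 / -15660)

[OURS · leafhand-res-equisingularlift-12 g0, 2026-08-31; cell `pub/decomp-res`] AI-produced, weaker than expert review; NOT a statement of any manuscript;
nothing here proves resolution of singularities in positive characteristic.  DEF-FREE helper; no `sorry`; standard axioms; ZERO named hypotheses.

* ★★★ `isoHypPoint_of_towerVertices` — `K = K̄`, `F` a prime form, `S` a list of coordinate vertices whose charts have multiplicity `μ ≥ 2` and are singular at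
  most at the origin, the other charts regular; if for every `c ∈ S` some point over `P_c` has SOME `D`-level (for a blow-up tower `D`), then `IsoHypPoint`
  (✓ `isoHypPoint_of_towerPoints` + the vertex bookkeeping of ✓ `isoHypPoint_of_oneStepVertices` + ✓ `not_isRegularLocalRing_stalk_vertex`);
* ★★ `SecondOrderPoint.A₅_markedTowerData` — the marked data of `y₀y₁ + y₂⁶` with level-`≤ 1` payload at the mark (the `A₃` specimen), for every tower;
* ★★★ `towerLevel_two_vertex_A₅` — a vertex of `V₊(F)` with chart `y₀y₁ + y₂⁶` has `D`-level `2` (✓ `towerLevel_succ_vertex_marked`);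
* ★★★ `isoHypPoint_of_A₅Vertices` — a prime surface `V₊(F) ⊆ ℙ³_K̄` whose singular points are vertices with chart `y₀y₁ + y₂⁶` satisfies `IsoHypPoint`
  (every characteristic) — OUTSIDE the isolated residual.

Honest label: closes no registered stub.

References: [Hartshorne1977, I Thm. 5.1, I Ex. 5.6, II Ex. 7.12]; [Lipman1969, §24]; [StacksProject, Tags 0804, 080E]; through the cited tree files.
-/

set_option linter.dupNamespace false -- mandated namespace `Summit.<Summit>.<Problem>` of this single-conjunct summit

noncomputable section

open CategoryTheory CategoryTheory.Limits AlgebraicGeometry TopologicalSpace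
open Literature.AlgebraicGeometry.Resolution Literature.AlgebraicGeometry.Motives
open AlgebraicGeometry.Scheme.IdealSheafData
open MvPolynomial HomogeneousLocalization
open Literature.AlgebraicGeometry.Motives.SmoothHypersurface Literature.AlgebraicGeometry.Motives.ProjectiveSpace
open Summit.ResolutionOfSingularities.ResolutionOfSingularities.Cruxes.EquisingularLift.StrataSplit

namespace Summit.ResolutionOfSingularities.ResolutionOfSingularities.Cruxes.EquisingularLiftNat.Sections

/-- ★★★ **SEVERAL VERTICES OF FINITE BLOW-UP DEPTH ⟹ `IsoHypPoint`.** [OURS] [cite: Hartshorne1977, I Thm. 5.1] [cite: StacksProject, Tag 080E] -/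
theorem isoHypPoint_of_towerVertices (K : Type) [Field K] [IsAlgClosed K] {m : ℕ} (D : ℕ → ∀ Γ : Scheme.{0}, Γ → Prop)
    (hD0 : ∀ (Γ : Scheme.{0}) (y : Γ), IsClosed (({y} : Set Γ)) →
      (D 0 Γ y ↔ ∀ (hy : IsClosed (({y} : Set Γ))) (Z : Scheme.{0}) (τ : Z ⟶ Γ), IsBlowup τ (vanishingIdeal ⟨{y}, hy⟩) →
        ∀ z : Z, τ z = y → IsRegularLocalRing (Z.presheaf.stalk z)))
    (hDsucc : ∀ (d : ℕ) (Γ : Scheme.{0}) (y : Γ), IsClosed (({y} : Set Γ)) →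
      (D (d + 1) Γ y ↔ ∀ (hy : IsClosed (({y} : Set Γ))) (Z : Scheme.{0}) (τ : Z ⟶ Γ), IsBlowup τ (vanishingIdeal ⟨{y}, hy⟩) →
        ∃ S' : Finset Z, (∀ z : Z, τ z = y → z ∉ S' → IsRegularLocalRing (Z.presheaf.stalk z)) ∧
          ∀ z ∈ S', τ z = y ∧ IsClosed (({z} : Set Z)) ∧ ∃ d' ≤ d, D d' Z z))
    (F : MvPolynomial (Fin (m + 2 + 1)) K) {d : ℕ} (hF : F.IsHomogeneous d) (hFp : Prime F)
    (S : List (Fin (m + 2 + 1)))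
    (hsplit : ∀ c ∈ S, ∃ (μ : ℕ) (Φ Ψ : MvPolynomial (Fin (m + 2)) K), 2 ≤ μ ∧ Φ.IsHomogeneous μ ∧
      Ψ ∈ Ideal.span (Set.range (X : Fin (m + 2) → MvPolynomial (Fin (m + 2)) K)) ^ (μ + 1) ∧ ProjectiveSpace.dehomogenize K c F = Φ + Ψ)
    (hsing : ∀ c ∈ S, ∀ P : Ideal (MvPolynomial (Fin (m + 2)) K), P.IsPrime → ProjectiveSpace.dehomogenize K c F ∈ P →
      (∀ j, pderiv j (ProjectiveSpace.dehomogenize K c F) ∈ P) → ∀ j, (X j : MvPolynomial (Fin (m + 2)) K) ∈ P)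
    (hoff : letI := MvPolynomial.gradedAlgebra (σ := Fin (m + 2 + 1)) (R := K)
      ∀ c, c ∉ S → IsRegularRing (ChartRing F c hF))
    (hdepth : letI := MvPolynomial.gradedAlgebra (σ := Fin (m + 2 + 1)) (R := K)
      ∀ c ∈ S, ∃ x : ↥(hypersurface F).left, (∀ a : Fin (m + 2 + 1), a ≠ c →
        (X a : MvPolynomial (Fin (m + 2 + 1)) K) ∈ ((hypersurfaceι F).left x).asHomogeneousIdeal) ∧ ∃ n, D n (hypersurface F).left x) :
    letI := MvPolynomial.gradedAlgebra (σ := Fin (m + 2 + 1)) (R := K)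
    IsoHypPoint K (m + 2) (hypersurface F).left (hypersurfaceι F).left := by
  letI := MvPolynomial.gradedAlgebra (σ := Fin (m + 2 + 1)) (R := K)
  letI := MvPolynomial.gradedAlgebra (σ := Fin (0 + 1)) (R := K)
  classical
  haveI := HypersurfaceSpecimen.isIntegral_hypersurface_of_prime K F hF hFp
  have hd : 0 < d := ConeN.pos_of_prime_of_isHomogeneous K F hF hFp
  have hιinj : Function.Injective (hypersurfaceι F).left := (hypersurfaceι F).left.isClosedEmbedding.injective
  have he : ∀ c : Fin (m + 2 + 1), Function.Injective (fun _ : Fin 1 => c) := fun c => Function.injective_of_subsingleton _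
  have hec : ∀ c : Fin (m + 2 + 1), ∀ j : Fin 1, (fun _ : Fin 1 => c) j = c := fun _ _ => rfl
  have hexk : ∀ c : Fin (m + 2 + 1), ∃ (g : homogeneousSubmodule (Fin (m + 2 + 1)) K →+*ᵍ homogeneousSubmodule (Fin (0 + 1)) K)
      (_ : HomogeneousIdeal.irrelevant (homogeneousSubmodule (Fin (0 + 1)) K) ≤
        (HomogeneousIdeal.irrelevant (homogeneousSubmodule (Fin (m + 2 + 1)) K)).map g),
      (∀ a : K, g (C a) = C a) ∧ (∀ j : Fin 1, g (X ((fun _ : Fin 1 => c) j)) = X j) ∧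
        (∀ i : Fin (m + 2 + 1), i ∉ Set.range (fun _ : Fin 1 => c) → g (X i) = 0) := fun c =>
    LinearCentre.exists_kill (R := K) (fun _ : Fin 1 => c) (he c)
  choose fk hfk' hfkC hfke hfk0 using hexk
  have hfke' : ∀ c (j : Fin 1), fk c (X c) = X j := fun c j => hfke c j
  have hfk0' : ∀ c (i : Fin (m + 2 + 1)), i ≠ c → fk c (X i) = 0 := fun c i hi => hfk0 c i (fun ⟨_, hj⟩ => hi hj.symm)
  have hsplit' : ∀ c ∈ S, ∃ (μ : ℕ) (Φ Ψ : MvPolynomial (Fin (m + 2)) K), 1 ≤ μ ∧ Φ.IsHomogeneous μ ∧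
      Ψ ∈ Ideal.span (Set.range (X : Fin (m + 2) → MvPolynomial (Fin (m + 2)) K)) ^ (μ + 1) ∧ ProjectiveSpace.dehomogenize K c F = Φ + Ψ := by
    intro c hc
    obtain ⟨μ, Φ, Ψ, hμ, hΦ, hΨ, hdeh⟩ := hsplit c hc
    exact ⟨μ, Φ, Ψ, by omega, hΦ, hΨ, hdeh⟩
  have hrad : ∀ c ∈ S, (Ideal.span {ProjectiveSpace.dehomogenize K c F}).radical = Ideal.span {ProjectiveSpace.dehomogenize K c F} := by
    intro c hc
    obtain ⟨μ, Φ, Ψ, hμ, hΦ, hΨ, hdeh⟩ := hsplit' c hc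
    rw [hdeh]
    exact OrdPointAt.radical_span_dehomogenize_eq K F c hF hFp Φ Ψ hΦ hμ hΨ hdeh
  -- the vertex points
  have hvert : ∀ c, c ∈ S → ∃ (x₀ : ↥(hypersurface F).left)
      (hx₀cl : IsClosed ({(hypersurfaceι F).left x₀} : Set (Proj (homogeneousSubmodule (Fin (m + 2 + 1)) K))))
      (hx₀cl' : IsClosed ({x₀} : Set ↥(hypersurface F).left)),
      ((Proj.map (fk c) (hfk' c)).ker.support : Set (Proj (homogeneousSubmodule (Fin (m + 2 + 1)) K))) = {(hypersurfaceι F).left x₀} ∧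
      (∀ a : Fin (m + 2 + 1), a ≠ c → (X a : MvPolynomial (Fin (m + 2 + 1)) K) ∈ ((hypersurfaceι F).left x₀).asHomogeneousIdeal) ∧
      vanishingIdeal ⟨{(hypersurfaceι F).left x₀}, hx₀cl⟩ = (Proj.map (fk c) (hfk' c)).ker ∧
      ((Proj.map (fk c) (hfk' c)).ker).comap (hypersurfaceι F).left = vanishingIdeal ⟨{x₀}, hx₀cl'⟩ := fun c hc =>
    exists_vertexPoint K F hF c (hsplit' c hc) (fk c) (hfk' c) (hfkC c) (hfke' c) (hfk0' c)
  choose xpt hxcl hxcl' hxsupp hxX hxΛ hxcomap using hvert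
  have huniq : ∀ (c : Fin (m + 2 + 1)) (hc : c ∈ S) (x : ↥(hypersurface F).left),
      (∀ a : Fin (m + 2 + 1), a ≠ c → (X a : MvPolynomial (Fin (m + 2 + 1)) K) ∈ ((hypersurfaceι F).left x).asHomogeneousIdeal) →
      x = xpt c hc := by
    intro c hc x hxXa
    have hxmem : (hypersurfaceι F).left x ∈ ((Proj.map (fk c) (hfk' c)).ker.support : Set (Proj (homogeneousSubmodule (Fin (m + 2 + 1)) K))) := by
      by_contra h
      obtain ⟨a, ha, hXa⟩ := LinearCentre.exists_X_not_mem_of_not_mem_support (fun _ : Fin 1 => c) (he c) (fk c) (hfk' c) (hfkC c) (hfke c)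
        (hfk0 c) h
      exact hXa (hxXa a ((OrdPointAt.not_mem_range_iff c (hec c) a).mp ha))
    rw [hxsupp c hc] at hxmem
    exact hιinj (Set.mem_singleton_iff.mp hxmem)
  let SH : Finset ↥(hypersurface F).left := S.toFinset.attach.image (fun c => xpt c.1 (List.mem_toFinset.mp c.2))
  have hmemSH : ∀ x, x ∈ SH → ∃ (c : Fin (m + 2 + 1)) (hc : c ∈ S), xpt c hc = x := fun x hx => by
    obtain ⟨c, -, h⟩ := Finset.mem_image.mp hx
    exact ⟨c.1, List.mem_toFinset.mp c.2, h⟩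
  have hmemSH' : ∀ (c : Fin (m + 2 + 1)) (hc : c ∈ S), xpt c hc ∈ SH := fun c hc =>
    Finset.mem_image.mpr ⟨⟨c, List.mem_toFinset.mpr hc⟩, Finset.mem_attach _ _, rfl⟩
  refine isoHypPoint_of_towerPoints K (m + 2) (hypersurface F).left (hypersurfaceι F).left D hD0 hDsucc SH ?_ ?_ ?_ ?_
  · intro x hx
    obtain ⟨c, hc, rfl⟩ := hmemSH x hx
    exact hxcl c hc
  · intro x hx
    obtain ⟨c, hc, rfl⟩ := hmemSH x hx
    exact not_isRegularLocalRing_stalk_vertex K F hF hFp c (hsplit c hc) _ (hxX c hc)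
  · intro x hx
    refine MultiOrd.isRegularLocalRing_stalk_of_forall_exists K F hF hd S (fun c hc => ⟨hrad c hc, hsing c hc⟩) hoff x (fun c hc => ?_)
    have hxc : (hypersurfaceι F).left x ∉ ((Proj.map (fk c) (hfk' c)).ker.support : Set (Proj (homogeneousSubmodule (Fin (m + 2 + 1)) K))) := by
      rw [hxsupp c hc]
      intro h
      exact hx (by rw [hιinj (Set.mem_singleton_iff.mp h)]; exact hmemSH' c hc)
    obtain ⟨a, ha, hXa⟩ := LinearCentre.exists_X_not_mem_of_not_mem_support (fun _ : Fin 1 => c) (he c) (fk c) (hfk' c) (hfkC c) (hfke c)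
      (hfk0 c) hxc
    exact ⟨a, (OrdPointAt.not_mem_range_iff c (hec c) a).mp ha, (Proj.mem_basicOpen _ _ _).mpr hXa⟩
  · intro x hx
    obtain ⟨c, hc, rfl⟩ := hmemSH x hx
    obtain ⟨x', hx'X, n, hn⟩ := hdepth c hc
    have hxe : x' = xpt c hc := huniq c hc x' hx'X
    subst hxe
    exact ⟨n, hn⟩

/-- ★★ **THE MARKED TOWER DATA OF THE `A₅` SPECIMEN `y₀y₁ + y₂⁶`**, with the level-`≤ 1` payload at its only mark (the `A₃` specimen at the origin of chart `2`),
for every blow-up tower `D` — VERBATIM the hypotheses `G, hG, Marks, hjac, hlev` of ✓ `OneStep.towerLevel_succ_origin_marked` / ✓ `towerLevel_succ_vertex_marked`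
with `d = 1`. [OURS] [cite: Hartshorne1977, I Thm. 5.1, I Ex. 5.6, II Ex. 7.12] -/
theorem SecondOrderPoint.A₅_markedTowerData (K : Type) [Field K] (D : ℕ → ∀ Γ : Scheme.{0}, Γ → Prop)
    (hD0 : ∀ (Γ : Scheme.{0}) (y : Γ), IsClosed (({y} : Set Γ)) →
      (D 0 Γ y ↔ ∀ (hy : IsClosed (({y} : Set Γ))) (Z : Scheme.{0}) (τ : Z ⟶ Γ), IsBlowup τ (vanishingIdeal ⟨{y}, hy⟩) →
        ∀ z : Z, τ z = y → IsRegularLocalRing (Z.presheaf.stalk z)))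
    (hDsucc : ∀ (d : ℕ) (Γ : Scheme.{0}) (y : Γ), IsClosed (({y} : Set Γ)) →
      (D (d + 1) Γ y ↔ ∀ (hy : IsClosed (({y} : Set Γ))) (Z : Scheme.{0}) (τ : Z ⟶ Γ), IsBlowup τ (vanishingIdeal ⟨{y}, hy⟩) →
        ∃ S' : Finset Z, (∀ z : Z, τ z = y → z ∉ S' → IsRegularLocalRing (Z.presheaf.stalk z)) ∧
          ∀ z ∈ S', τ z = y ∧ IsClosed (({z} : Set Z)) ∧ ∃ d' ≤ d, D d' Z z)) :
    (X 2 ^ 6 : MvPolynomial (Fin 3) K) ∈ Ideal.span (Set.range (X : Fin 3 → MvPolynomial (Fin 3) K)) ^ (2 + 1) ∧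
    ∃ (G : Fin 3 → MvPolynomial (Fin 3) K) (Marks : Fin 3 → Finset (Fin 3 → K)),
      (∀ a, aeval (fun j => X a * Function.update (X : Fin 3 → MvPolynomial (Fin 3) K) a 1 j) (X 0 * X 1 + X 2 ^ 6 : MvPolynomial (Fin 3) K) =
        X a ^ 2 * G a) ∧
      (∀ a, ∀ P : Ideal (MvPolynomial (Fin 3) K), P.IsPrime → (X a : MvPolynomial (Fin 3) K) ∈ P → G a ∈ P →
        (∃ j, pderiv j (G a) ∉ P) ∨ ∃ lam ∈ Marks a, ∀ i, (X i - C (lam i) : MvPolynomial (Fin 3) K) ∈ P) ∧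
      (∀ a, ∀ lam ∈ Marks a, G a ∈ Ideal.span (Set.range fun i : Fin 3 => (X i - C (lam i) : MvPolynomial (Fin 3) K)) →
        ∃ (μ' : ℕ) (Φ' Ψ' : MvPolynomial (Fin 3) K), 1 ≤ μ' ∧ Φ'.IsHomogeneous μ' ∧
          Ψ' ∈ Ideal.span (Set.range (X : Fin 3 → MvPolynomial (Fin 3) K)) ^ (μ' + 1) ∧
          aeval (fun i => X i + C (lam i)) (G a) = Φ' + Ψ' ∧
          ∀ y' : Spec (CommRingCat.of (MvPolynomial (Fin 3) K ⧸ Ideal.span {Φ' + Ψ'})),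
            y'.asIdeal = Ideal.map (Ideal.Quotient.mk (Ideal.span {Φ' + Ψ'})) (Ideal.span (Set.range (X : Fin 3 → MvPolynomial (Fin 3) K))) →
            ∃ d' ≤ 1, D d' (Spec (CommRingCat.of (MvPolynomial (Fin 3) K ⧸ Ideal.span {Φ' + Ψ'}))) y') := by
  classical
  have hΦ : (X 0 * X 1 : MvPolynomial (Fin 3) K).IsHomogeneous 2 := by
    simpa using (isHomogeneous_X K (0 : Fin 3)).mul (isHomogeneous_X K (1 : Fin 3))
  have hΦ0 : (X 0 * X 1 : MvPolynomial (Fin 3) K) ≠ 0 := mul_ne_zero (X_ne_zero 0) (X_ne_zero 1)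
  have hΨ6 := SecondOrderPoint.A₅_tail_mem_pow K
  obtain ⟨⟨G₀, hG₀, hJ₀⟩, ⟨G₁, hG₁, hJ₁⟩, -⟩ := SecondOrderPoint.A_charts_regular_off_origin₂ K hΨ6
  have hG₂ := SecondOrderPoint.A₅_strictTransform₂ K
  have hG₂' : (X 0 * X 1 + X 2 ^ 4 : MvPolynomial (Fin 3) K) - X 0 * X 1 ∈ Ideal.span {(X 2 : MvPolynomial (Fin 3) K)} :=
    Ideal.mem_span_singleton'.mpr ⟨X 2 ^ 3, by ring⟩
  obtain ⟨hΨ4, GA, hGA, hjacA, hsecA⟩ := SecondOrderPoint.A₃_specimen_twoStepData K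
  have hlevA : ∀ y' : Spec (CommRingCat.of (MvPolynomial (Fin 3) K ⧸ Ideal.span {(X 0 * X 1 + X 2 ^ 4 : MvPolynomial (Fin 3) K)})),
      y'.asIdeal = Ideal.map (Ideal.Quotient.mk (Ideal.span {(X 0 * X 1 + X 2 ^ 4 : MvPolynomial (Fin 3) K)}))
        (Ideal.span (Set.range (X : Fin 3 → MvPolynomial (Fin 3) K))) →
      ∃ d' ≤ 1, D d' (Spec (CommRingCat.of (MvPolynomial (Fin 3) K ⧸ Ideal.span {(X 0 * X 1 + X 2 ^ 4 : MvPolynomial (Fin 3) K)}))) y' := by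
    intro y' hy'
    have hmax' := OneStep.isMaximal_map_mk_span_range_X K (X 0 * X 1) (X 2 ^ 4) (by norm_num) hΦ hΨ4
    have hy'cl : IsClosed ({y'} : Set _) := (PrimeSpectrum.isClosed_singleton_iff_isMaximal y').mpr (hy' ▸ hmax')
    have h2 := OneStep.twoStepAt_origin K (X 0 * X 1) (X 2 ^ 4) (by norm_num) hΦ hΦ0 hΨ4 GA hGA hjacA hsecA y' hy'
    refine ⟨1, le_rfl, (hDsucc 0 _ y' hy'cl).mpr fun hy Z τ hτ => ?_⟩
    obtain ⟨S', hreg, hS'⟩ := h2 hy Z τ hτ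
    refine ⟨S', hreg, fun z hz => ?_⟩
    obtain ⟨hτz, hzcl, hone⟩ := hS' z hz
    exact ⟨hτz, hzcl, 0, le_rfl, (hD0 Z z hzcl).mpr fun _ Z' τ' hτ' z' hz' => hone Z' τ' hτ' z' hz'⟩
  refine ⟨hΨ6, ![G₀, G₁, X 0 * X 1 + X 2 ^ 4], ![∅, ∅, {(0 : Fin 3 → K)}], fun a => ?_, fun a P hP haP hGP => ?_, fun a lam hlam _ => ?_⟩
  · fin_cases a
    · exact hG₀
    · exact hG₁
    · exact hG₂
  · fin_cases a
    · exact Or.inl (hJ₀ P hP haP)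
    · exact Or.inl (hJ₁ P hP haP)
    · by_cases hall : ∀ j, pderiv j (X 0 * X 1 + X 2 ^ 4 : MvPolynomial (Fin 3) K) ∈ P
      · right
        refine ⟨0, Finset.mem_singleton_self _, fun i => ?_⟩
        simpa using SecondOrderPoint.forall_X_mem_of_sub_mul_mem_span₃ K hG₂' P haP (hall 0) (hall 1) i
      · left
        push Not at hall
        exact hall
  · fin_cases a
    · simp at hlam
    · simp at hlam
    · have hlam0 : lam = 0 := by simpa using hlam
      subst hlam0
      refine ⟨2, X 0 * X 1, X 2 ^ 4, by norm_num, hΦ, hΨ4, ?_, hlevA⟩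
      have h0 : (fun i : Fin 3 => X i + C ((0 : Fin 3 → K) i)) = (X : Fin 3 → MvPolynomial (Fin 3) K) := by
        funext i; simp
      simp only [h0, MvPolynomial.aeval_X_left, AlgHom.coe_id, id_eq]
      rfl

/-- **The `A₅` specimen chart is singular at most at its origin** (every characteristic): `∂₀ = y₁`, `∂₁ = y₀`, and `y₂⁶ = f − y₀y₁`. [cite: Hartshorne1977, I Thm. 5.1] -/
theorem SecondOrderPoint.A₅_singular_only_origin (K : Type) [Field K]
    (P : Ideal (MvPolynomial (Fin 3) K)) (hP : P.IsPrime) (hf : (X 0 * X 1 + X 2 ^ 6 : MvPolynomial (Fin 3) K) ∈ P)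
    (hd : ∀ j, pderiv j (X 0 * X 1 + X 2 ^ 6 : MvPolynomial (Fin 3) K) ∈ P) (j : Fin 3) :
    (X j : MvPolynomial (Fin 3) K) ∈ P := by
  have hd0 : pderiv 0 (X 0 * X 1 + X 2 ^ 6 : MvPolynomial (Fin 3) K) = X 1 := by
    rw [map_add, pderiv_mul, pderiv_X_self, pderiv_X_of_ne (by decide : (1 : Fin 3) ≠ 0), pderiv_pow,
      pderiv_X_of_ne (by decide : (2 : Fin 3) ≠ 0)]
    ring
  have hd1 : pderiv 1 (X 0 * X 1 + X 2 ^ 6 : MvPolynomial (Fin 3) K) = X 0 := by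
    rw [map_add, pderiv_mul, pderiv_X_of_ne (by decide : (0 : Fin 3) ≠ 1), pderiv_X_self, pderiv_pow,
      pderiv_X_of_ne (by decide : (2 : Fin 3) ≠ 1)]
    ring
  have hX1 : (X 1 : MvPolynomial (Fin 3) K) ∈ P := by rw [← hd0]; exact hd 0
  have hX0 : (X 0 : MvPolynomial (Fin 3) K) ∈ P := by rw [← hd1]; exact hd 1
  have hX2 : (X 2 : MvPolynomial (Fin 3) K) ∈ P := by
    refine hP.mem_of_pow_mem 6 ?_
    have e : (X 2 ^ 6 : MvPolynomial (Fin 3) K) = (X 0 * X 1 + X 2 ^ 6) - X 0 * X 1 := by ring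
    rw [e]
    exact P.sub_mem hf (P.mul_mem_left _ hX1)
  fin_cases j
  · simpa using hX0
  · simpa using hX1
  · simpa using hX2

/-- ★★★ **`A₅` VERTICES HAVE LEVEL `2`**: `F` a form of positive degree whose vertex chart is `y₀y₁ + y₂⁶` (radical): the point of `V₊(F)` over `P_c` has
`D`-level `2` in every blow-up tower. [OURS] [cite: Hartshorne1977, I Thm. 5.1, I Ex. 5.6] -/
theorem towerLevel_two_vertex_A₅ (K : Type) [Field K] (D : ℕ → ∀ Γ : Scheme.{0}, Γ → Prop)
    (hD0 : ∀ (Γ : Scheme.{0}) (y : Γ), IsClosed (({y} : Set Γ)) →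
      (D 0 Γ y ↔ ∀ (hy : IsClosed (({y} : Set Γ))) (Z : Scheme.{0}) (τ : Z ⟶ Γ), IsBlowup τ (vanishingIdeal ⟨{y}, hy⟩) →
        ∀ z : Z, τ z = y → IsRegularLocalRing (Z.presheaf.stalk z)))
    (hDsucc : ∀ (d : ℕ) (Γ : Scheme.{0}) (y : Γ), IsClosed (({y} : Set Γ)) →
      (D (d + 1) Γ y ↔ ∀ (hy : IsClosed (({y} : Set Γ))) (Z : Scheme.{0}) (τ : Z ⟶ Γ), IsBlowup τ (vanishingIdeal ⟨{y}, hy⟩) →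
        ∃ S' : Finset Z, (∀ z : Z, τ z = y → z ∉ S' → IsRegularLocalRing (Z.presheaf.stalk z)) ∧
          ∀ z ∈ S', τ z = y ∧ IsClosed (({z} : Set Z)) ∧ ∃ d' ≤ d, D d' Z z))
    (F : MvPolynomial (Fin (1 + 2 + 1)) K) {d : ℕ} (hF : F.IsHomogeneous d) (hd : 0 < d) (c : Fin (1 + 2 + 1))
    (hdeh : ProjectiveSpace.dehomogenize K c F = X 0 * X 1 + X 2 ^ 6)
    (hrad : (Ideal.span {(X 0 * X 1 + X 2 ^ 6 : MvPolynomial (Fin 3) K)}).radical = Ideal.span {(X 0 * X 1 + X 2 ^ 6 : MvPolynomial (Fin 3) K)}) :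
    letI := MvPolynomial.gradedAlgebra (σ := Fin (1 + 2 + 1)) (R := K)
    ∃ (x₀ : ↥(hypersurface F).left) (_ : IsClosed ({x₀} : Set ↥(hypersurface F).left)),
      (∀ a : Fin (1 + 2 + 1), a ≠ c → (X a : MvPolynomial (Fin (1 + 2 + 1)) K) ∈ ((hypersurfaceι F).left x₀).asHomogeneousIdeal) ∧
      D 2 (hypersurface F).left x₀ := by
  obtain ⟨hΨ, G, Marks, hG, hjac, hlev⟩ := SecondOrderPoint.A₅_markedTowerData K D hD0 hDsucc
  have hΦ : (X 0 * X 1 : MvPolynomial (Fin 3) K).IsHomogeneous 2 := by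
    simpa using (isHomogeneous_X K (0 : Fin 3)).mul (isHomogeneous_X K (1 : Fin 3))
  have hΦ0 : (X 0 * X 1 : MvPolynomial (Fin 3) K) ≠ 0 := mul_ne_zero (X_ne_zero 0) (X_ne_zero 1)
  exact towerLevel_succ_vertex_marked K D hD0 hDsucc 1 F hF hd c (X 0 * X 1) (X 2 ^ 6) (by norm_num) hΦ hΦ0 hΨ hdeh hrad G hG Marks hjac hlev

/-- ★★★ **SEVERAL `A₅` VERTICES OF A PRIME SURFACE OVER `K̄` ⟹ `IsoHypPoint`** (every characteristic): `F ∈ K[x₀,…,x₃]` a prime form whose charts at the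
vertices `c ∈ S` are `y₀y₁ + y₂⁶` and whose other charts are regular. [OURS] [cite: Hartshorne1977, I Thm. 5.1, I Ex. 5.6] [cite: StacksProject, Tag 080E] -/
theorem isoHypPoint_of_A₅Vertices (K : Type) [Field K] [IsAlgClosed K]
    (F : MvPolynomial (Fin (1 + 2 + 1)) K) {d : ℕ} (hF : F.IsHomogeneous d) (hFp : Prime F) (S : List (Fin (1 + 2 + 1)))
    (hA₅ : ∀ c ∈ S, ProjectiveSpace.dehomogenize K c F = X 0 * X 1 + X 2 ^ 6)
    (hoff : letI := MvPolynomial.gradedAlgebra (σ := Fin (1 + 2 + 1)) (R := K)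
      ∀ c, c ∉ S → IsRegularRing (ChartRing F c hF)) :
    letI := MvPolynomial.gradedAlgebra (σ := Fin (1 + 2 + 1)) (R := K)
    IsoHypPoint K (1 + 2) (hypersurface F).left (hypersurfaceι F).left := by
  obtain ⟨D, hD0, hDsucc⟩ := exists_blowupTower
  have hd : 0 < d := ConeN.pos_of_prime_of_isHomogeneous K F hF hFp
  have hΦ : (X 0 * X 1 : MvPolynomial (Fin 3) K).IsHomogeneous 2 := by
    simpa using (isHomogeneous_X K (0 : Fin 3)).mul (isHomogeneous_X K (1 : Fin 3))
  have hsplit : ∀ c ∈ S, ∃ (μ : ℕ) (Φ Ψ : MvPolynomial (Fin (1 + 2)) K), 2 ≤ μ ∧ Φ.IsHomogeneous μ ∧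
      Ψ ∈ Ideal.span (Set.range (X : Fin (1 + 2) → MvPolynomial (Fin (1 + 2)) K)) ^ (μ + 1) ∧ ProjectiveSpace.dehomogenize K c F = Φ + Ψ :=
    fun c hc => ⟨2, X 0 * X 1, X 2 ^ 6, le_rfl, hΦ, SecondOrderPoint.A₅_tail_mem_pow K, hA₅ c hc⟩
  refine isoHypPoint_of_towerVertices K D hD0 hDsucc F hF hFp S hsplit (fun c hc P hP hfP hdP j => ?_) hoff (fun c hc => ?_)
  · rw [hA₅ c hc] at hfP hdP
    exact SecondOrderPoint.A₅_singular_only_origin K P hP hfP hdP j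
  · have hrad : (Ideal.span {(X 0 * X 1 + X 2 ^ 6 : MvPolynomial (Fin 3) K)}).radical =
        Ideal.span {(X 0 * X 1 + X 2 ^ 6 : MvPolynomial (Fin 3) K)} :=
      OrdPointAt.radical_span_dehomogenize_eq K F c hF hFp (X 0 * X 1) (X 2 ^ 6) hΦ (by norm_num) (SecondOrderPoint.A₅_tail_mem_pow K) (hA₅ c hc)
    obtain ⟨x₀, -, hx₀X, hlev⟩ := towerLevel_two_vertex_A₅ K D hD0 hDsucc F hF hd c (hA₅ c hc) hrad
    exact ⟨x₀, hx₀X, 2, hlev⟩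

end Summit.ResolutionOfSingularities.ResolutionOfSingularities.Cruxes.EquisingularLiftNat.Sections

end
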